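import Literature.Probability.RandomPlanarGeometry.HexSAWBrickWallStripInsertion
import Literature.Probability.RandomPlanarGeometry.HexSAWBrickWallStripInsertionCore
import Literature.Probability.RandomPlanarGeometry.HexSAWBrickWallStripDictionary
import Literature.Probability.RandomPlanarGeometry.HexSAWHammersleyWelshExplicit
import Literature.Probability.RandomPlanarGeometry.HexSAWLemma2
import Mathlib.Analysis.SpecificLimits.Normed
import HarnessLib

/-!
# Sub-criticality of the honeycomb strips at `x_c` and the transfer of strip walks to brick-wall strip pairs
# (BBdGDCG 2014, proof of Proposition 9 — first ingredient)

Topic `Literature/Probability/RandomPlanarGeometry` (continues the brick-wall strip files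
`HexSAWHammersleyWelshExplicit.lean` — `HexBW.stripPairs / stripCount / stripConnectiveConstant`,
`HexBW.tendsto_stripCount_rpow`, `HexBW.stripConnectiveConstant_le` —, the four-column insertion
`HexSAWBrickWallStripInsertion(Core).lean` — `HexBW.stripConnectiveConstant_lt_succ_of_insertion`,
`HexBW.stripInsertion*` — and the dictionary `HexSAWBrickWallStripDictionary.lean` — `rowIso`, levels ↔ rows).
Source: N. R. Beaton, M. Bousquet-Mélou, J. de Gier, H. Duminil-Copin, A. J. Guttmann, *The critical fugacity for
surface adsorption of self-avoiding walks on the honeycomb lattice is `1 + √2`*, Comm. Math. Phys. 326 (2014)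
727–754, arXiv:1109.0358v5, Corollary 8 at `y = 1` (p. 12: `ρ_T(1) = 1/μ_{T−1}(1,1) > x_c`, by the strict increase
of `μ_T(1,1)` to `μ` in Proposition 7, pp. 11–12), used in the proof of Proposition 9 (p. 14) in the words "But the generating
function of walks in the T-strip converges at (x_c; y) for y < y_T (see Corollary 8), and thus its remainder of order L tends
to 0 as L grows."  MECHANISM HERE: the lane strip insertion (door HEX-STRIP-STRICT, `μ(S_T) < μ_ℍ = 1/x_c`), not the printed
unfolded arches.

## What is proved

* `summable_stripCount_mul_pow T'` — `Σ_m c_m(S_{T'}) x_c^m < ∞` (`c_m^{1/m} → μ(S_{T'}) < μ(S_{T'+1}) ≤ μ_ℍ = 1/x_c`);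
* `toBWList`, `toPair`, `toBWList_spec`, `toPair_mem`, `toPair_inj` — a self-avoiding `hvGraph`-chain in levels `0 … 2T−1`,
  read in brick-wall coordinates, is a strip pair of `HexBW.stripPairs (T−1) (length − 1)`; injective given the head.
-/

noncomputable section

open Finset Filter Topology Literature.Probability.LatticeModels Literature.Probability.Percolation SimpleGraph

namespace Literature.Probability.RandomPlanarGeometry.SAW.HV

/-! ### Strip sub-criticality: `Σ_m c_m(S_{T'}) x_c^m < ∞` -/

/-- **Sub-criticality of the brick-wall strips at `x_c`**: `Σ_m c_m(S_{T'}) x_c^m` converges, because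
`c_m(S_{T'})^{1/m} → μ(S_{T'}) < μ_ℍ = x_c⁻¹` (strict, `HexBW.stripConnectiveConstant_lt_hex`).
[cite: BeatonBousquetMelouDeGierDuminilCopinGuttmann2014, Corollary 8 at y = 1 and Proposition 7 (arXiv v5 pp. 11–12); proof of Proposition 9 (p. 14) — mechanism here: the lane strip insertion] -/
theorem summable_stripCount_mul_pow (T' : ℕ) :
    Summable (fun m : ℕ => (HexBW.stripCount T' m : ℝ) * hexCriticalFugacity ^ m) := by
  have hx := hexCriticalFugacity_pos_lt_one.1
  set μ := HexBW.stripConnectiveConstant T' with hμ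
  have hlt : μ < hexCriticalFugacity⁻¹ := by
    rw [← hexConnectiveConstant_eq_inv]
    -- `μ(S_{T'}) < μ(S_{T'+1}) ≤ μ_ℍ` (the tree's `HexBW.stripConnectiveConstant_lt_succ` of `HexSAWBrickWallStripStrict`,
    -- re-derived here from its two parents while that module's olean is being built)
    have hlt' : HexBW.stripConnectiveConstant T' < HexBW.stripConnectiveConstant (T' + 1) :=
      HexBW.stripConnectiveConstant_lt_succ_of_insertion (Ψ := HexBW.stripInsertion T')
        (cost := HexBW.stripInsertionCost T') (fun n p hp c hc => HexBW.stripInsertionCost_le n p hp c hc)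
        (fun n p R hp hR => HexBW.stripInsertion_mem n p R hp hR)
        (fun n => (HexBW.stripInsertion_injOn T' n).mono fun _ hq => HexBW.mem_insDom.1 (Finset.mem_coe.1 hq))
    exact lt_of_lt_of_le hlt' (HexBW.stripConnectiveConstant_le (T' + 1))
  have hμ0 : 0 < μ := HexBW.stripConnectiveConstant_pos T'
  set ρ := (μ + hexCriticalFugacity⁻¹) / 2 with hρ
  have hμρ : μ < ρ := by rw [hρ]; linarith
  have hρx : ρ * hexCriticalFugacity < 1 := by
    have : ρ < hexCriticalFugacity⁻¹ := by rw [hρ]; linarith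
    calc ρ * hexCriticalFugacity < hexCriticalFugacity⁻¹ * hexCriticalFugacity :=
          mul_lt_mul_of_pos_right this hx
      _ = 1 := inv_mul_cancel₀ hx.ne'
  have hρ0 : 0 < ρ := by linarith
  -- eventually `c_m^{1/m} < ρ`, hence `c_m x_c^m ≤ (ρ x_c)^m`
  have hev : ∀ᶠ m : ℕ in atTop, (HexBW.stripCount T' m : ℝ) * hexCriticalFugacity ^ m ≤ (ρ * hexCriticalFugacity) ^ m := by
    have h1 := (HexBW.tendsto_stripCount_rpow T').eventually (gt_mem_nhds hμρ)
    filter_upwards [h1, eventually_ge_atTop 1] with m hm hm1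
    have hc0 : (0 : ℝ) ≤ HexBW.stripCount T' m := Nat.cast_nonneg _
    have hpow : (HexBW.stripCount T' m : ℝ) ≤ ρ ^ m := by
      have h2 : ((HexBW.stripCount T' m : ℝ) ^ (1 / (m : ℝ))) ^ (m : ℝ) ≤ ρ ^ (m : ℝ) :=
        Real.rpow_le_rpow (Real.rpow_nonneg hc0 _) hm.le (Nat.cast_nonneg m)
      rw [← Real.rpow_mul hc0, one_div_mul_cancel (by positivity), Real.rpow_one, Real.rpow_natCast] at h2
      exact h2
    rw [mul_pow]
    exact mul_le_mul_of_nonneg_right hpow (pow_nonneg hx.le m)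
  refine Summable.of_norm_bounded_eventually_nat (summable_geometric_of_lt_one (by positivity) hρx) ?_
  filter_upwards [hev] with m hm
  rw [Real.norm_of_nonneg (by positivity)]
  exact hm

/-! ### Transfer: honeycomb vertex lists in a strip ↦ brick-wall strip pairs -/

/-- The brick-wall copy of a honeycomb vertex list (through the tree's `HexBW.rowIso`).
[cite: DuminilCopinSmirnov2012, §3 (the strip domains S_T)] -/
def toBWList (l : List HV) : List (Site 2) := l.map fun w => HexBW.rowIso.symm w

/-- The strip pair of a honeycomb vertex list: (cross-section representative of its brick-wall start, translate of the
brick-wall copy started at the origin). [cite: MadrasSlade1993, §8.2, eq. (8.2.1)] -/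
def toPair (l : List HV) : Site 2 × (ℕ → Site 2) :=
  (HexBW.snorm ((toBWList l).headD 0), fun s => HexBW.StripInsertion.ofList (toBWList l) s - (toBWList l).headD 0)

/-- `toBWList` facts: non-empty, nodup, chain, head, rows. [cite: DuminilCopinSmirnov2012, §3] -/
theorem toBWList_spec {l : List HV} (hl : l ≠ []) (hc : l.IsChain hvGraph.Adj) (hnd : l.Nodup) :
    toBWList l ≠ [] ∧ (toBWList l).Nodup ∧ (toBWList l).IsChain brickWallGraph.Adj ∧
      (toBWList l).head? = some ((toBWList l).headD 0) := by
  refine ⟨by simp [toBWList, hl], hnd.map HexBW.rowIso.symm.injective, ?_, ?_⟩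
  · rw [toBWList, List.isChain_map]
    exact hc.imp fun a b h => (HexBW.rowIso.symm.map_rel_iff).2 h
  · obtain ⟨a, l', rfl⟩ := List.exists_cons_of_ne_nil hl
    simp [toBWList]

/-- **A honeycomb self-avoiding vertex list with levels in `[0, 2T−1]` is (after the dictionary and re-basing) an
element of `HexBW.stripPairs (T−1) (|l| − 1)`.** [cite: MadrasSlade1993, §8.2, eq. (8.2.1)] -/
theorem toPair_mem {T : ℕ} (hT : 1 ≤ T) {l : List HV} (hl : l ≠ []) (hc : l.IsChain hvGraph.Adj) (hnd : l.Nodup)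
    (hlev : ∀ w ∈ l, 0 ≤ lev w ∧ lev w ≤ 2 * (T : ℤ) - 1) :
    toPair l ∈ HexBW.stripPairs (T - 1) (l.length - 1) := by
  obtain ⟨hne, hnd', hc', hh⟩ := toBWList_spec hl hc hnd
  set p := (toBWList l).headD 0 with hp
  have hlen : (toBWList l).length = l.length := List.length_map _
  obtain ⟨hsaws, hbw⟩ := HexBW.StripInsertion.ofList_sub_mem_saws hne hnd' hc' p hh
  rw [hlen] at hsaws hbw
  -- rows of the brick-wall copy
  have hrows : ∀ z ∈ toBWList l, HexBW.InStrip (T - 1) z := by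
    intro z hz
    rw [toBWList, List.mem_map] at hz
    obtain ⟨w, hw, rfl⟩ := hz
    rw [HexBW.rowIso_symm_mem_strip_iff]
    have := hlev w hw
    constructor
    · exact this.1
    · push_cast [hT]; omega
  have hpmem : p ∈ toBWList l := List.mem_of_mem_head? hh
  have hpstrip : HexBW.InStrip (T - 1) p := hrows p hpmem
  have heven := HexBW.snorm_shift_even p
  rw [toPair, HexBW.mem_stripPairs]
  refine ⟨HexBW.snorm_mem_stripStarts hpstrip, hsaws, ?_, ?_⟩
  · -- brick-wall bonds: translate the placed copy by the even vector `snorm p - p`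
    intro i hi
    have key := hbw i hi
    have e : ∀ s, HexBW.snorm p + (HexBW.StripInsertion.ofList (toBWList l) s - p) =
        (HexBW.snorm p - p) + HexBW.StripInsertion.ofList (toBWList l) s := fun s => by abel
    dsimp only
    rw [e, e, HexBW.adj_add_left_iff_of_even]
    · exact key
    · have : ((HexBW.snorm p - p) 0 + (HexBW.snorm p - p) 1) % 2 = 0 := by
        have h2 := heven
        simp only [Pi.sub_apply] at h2 ⊢
        omega
      exact this
  · -- rows: unchanged by the translation (snorm keeps the row)
    intro m _
    have hmem := HexBW.StripInsertion.ofList_mem hne m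
    have hin := hrows _ hmem
    have er : (HexBW.snorm p + (HexBW.StripInsertion.ofList (toBWList l) m - p)) 1 =
        (HexBW.StripInsertion.ofList (toBWList l) m) 1 := by
      simp [HexBW.snorm_apply_one]
    unfold HexBW.InStrip at hin ⊢
    rw [er]
    exact hin

/-- The transfer is injective among lists with the same head and the same length. [cite: MadrasSlade1993, §8.2] -/
theorem toPair_inj {l l' : List HV} (hl : l ≠ []) (hl' : l' ≠ []) (hh : l.head? = l'.head?)
    (hlen : l.length = l'.length) (h : toPair l = toPair l') : l = l' := by
  have hmap : toBWList l = toBWList l' := by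
    have hh' : (toBWList l).headD 0 = (toBWList l').headD 0 := by
      obtain ⟨a, m, rfl⟩ := List.exists_cons_of_ne_nil hl
      obtain ⟨a', m', rfl⟩ := List.exists_cons_of_ne_nil hl'
      simp only [List.head?_cons, Option.some.injEq] at hh
      simp [toBWList, hh]
    have h2 := congrArg Prod.snd h
    simp only [toPair] at h2
    refine HexBW.StripInsertion.ofList_inj (by simp [toBWList, hlen]) fun s => ?_
    have := congrFun h2 s
    rw [hh'] at this
    exact sub_left_inj.1 this
  have hinj : Function.Injective (fun w : HV => HexBW.rowIso.symm w) := HexBW.rowIso.symm.injective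
  exact (List.map_injective_iff.2 hinj) hmap

end Literature.Probability.RandomPlanarGeometry.SAW.HV
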